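import Literature.AnabelianGeometry.EtaleTheta.BiKummerThm44Sub
import Literature.AnabelianGeometry.EtaleTheta.BiKummerOfModelCanonical
import HarnessLib

/-!
# [EtTh] Theorem 4.4 (ii), sub-node T44-L12 "`Ψ` preserves pairs of morphisms whose `Div(−)`'s have
# disjoint supports" — PROVED for the [FrdI] Prop. 4.1 (iii) reading of "disjoint supports"

Proof-only companion (theorems only, no definitions) of `BiKummerThm44Sub.lean` (sub-DAG
`plan/L2/SUBDAG-EtTh-Thm44.md`, row EtTh:Thm4.4(ii)/T44-L12 `Thm44Hyp.PreservesDisjointSupports`; row owner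
abc-iut-L2-t3 by L2-lead 2026-08-26T02:59Z).  S. Mochizuki, *The étale theta function …*, Publ. RIMS
**45** (2009) [EtTh], §4, proof of Theorem 4.4, PDF p.95 ll.10–12 of `paper:doi-10-2977-prims-1234361159`
[cite: MochizukiEtTh2009, Thm 4.4 p.95]:

> "it follows immediately from the category-theoreticity of sets of primes given in [FrdI],
> Theorem 4.2, (ii), that `Ψ` preserves base-equivalent … pairs of pre-steps whose `Div(−)`'s have
> disjoint supports."

In the §4 setting (`BiKummerSetting`, abc-iut-L2-t3) "`Div(s')`, `Div(s'')` have disjoint supports" is a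
free field `DisjointSupports`; at the canonical model (`BiKummerSetting.mkOfModelCanonical`,
abc-iut-L2-t9) it is the [FrdI] Prop. 4.1 (iii) predicate "every `x` with `x ≤ Div(s')`, `x ≤ Div(s'')` is
`0`" (`mkOfModelCanonical_disjointSupports`; equivalent to disjointness of supports in a perfect
perf-factorial monoid).  For THAT reading the clause is proved here WITHOUT [FrdI] Thm. 4.2 (ii), by a
categorical characterisation of common divisors inside the model Frobenioid ([FrdI] Thm. 5.2 (i)):

* if `y ≤ Div(Ψ s')` and `y ≤ Div(Ψ s'')` in `Φ₂((Ψ A)_D)`, then — `Φ₂` being PERFECT (§4 p.86, field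
  `isPerfect`) — both `Ψ s'` and `Ψ s''` factor through the base-identity linear morphism
  `t₂ = (1, id, r, 0) : Ψ A → ((Ψ A)_D, [Ψ A] + r)` with `r = y^{1/(d′d″)}`, `d′ = deg_Fr(Ψ s')`,
  `d″ = deg_Fr(Ψ s'')` (the relation of a morphism `(d, f, z, u)` only sees `r^d ≤ z`);
* transporting along the (fully faithful) equivalence, `s'`, `s''` factor through the preimage
  `t₁ := Ψ⁻¹(t₂ ≫ ε⁻¹)`, so
  `Div(t₁) ≤ Div(s')`, `Div(t₁) ≤ Div(s'')` by the composition law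
  `Div(t ≫ w) = Base(t)^*Div(w) + deg_Fr(w)·Div(t)`, hence `Div(t₁) = 0` by the hypothesis on side 1;
* `Ψ` preserves isometries ([FrdI] Thm. 3.4 (ii), sub-node T44-L03), so `Div(Ψ t₁) = 0`; but
  `Ψ t₁ = t₂ ≫ (iso)`, whence `r = Div(t₂) = 0` (`Φ₂` divisorial: isomorphisms are isometries) and
  `y = r^{d′d″} = 0`.

* `Thm44Hyp.preservesDisjointSupports_of` (no definitions in this file) — for ANY two settings whose `DisjointSupports` fields imply
  (side 1) / are implied by (side 2) the Prop. 4.1 (iii) predicate, modulo "`Ψ` preserves isometries"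
  and `Φ₂` divisorial;
* `Thm44Hyp.preservesDisjointSupports_of_preservesFrobeniusStructure` — the same from sub-node T44-L03;
* `Thm44Hyp.preservesDisjointSupports_canonical` — row T44-L12 at the canonical instances on both sides
  (`DisjointSupports` = Prop. 4.1 (iii) definitionally), modulo T44-L03's isometry clause and
  `Φ₂` divisorial ([FrdI] Thm. 5.2 standing hypothesis / `treeCatVocab` field).
HONEST FRAMING: refereed pre-IUT material; nothing here bears on [IUTchIII] Cor. 3.12; no statement of the
paper is strengthened; the row's [FrdI] Thm. 4.2 (ii) INPUT is not used (a shorter route for this reading).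
-/

noncomputable section

namespace Literature.AnabelianGeometry.EtaleTheta

open CategoryTheory Opposite Literature.AlgebraicGeometry.Frobenioids

namespace BiKummerSetting

universe u₀ v₀ u v w

variable {K : Type u₀} [Field K] {K' : Type u₀} [Field K'] {D₀ : Type u₀} [Category.{v₀} D₀]
  {V : FrdIMonoidStub.{w}}
  {X₁ : SemiGraphs.TemperedArithmeticGroup.{u₀} K} {X₂ : SemiGraphs.TemperedArithmeticGroup.{u₀} K'}
  {D₀' : Type u₀} [Category.{v₀} D₀']
  {T₁ : RealifiedDivisorMonoids (D₀ := D₀) V} {T₂ : RealifiedDivisorMonoids (D₀ := D₀') V}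
  {D₁ D₂ : Type u} [Category.{v} D₁] [Category.{v} D₂] {VD₁ : FrdICatStub.{u, v, w} D₁}
  {VD₂ : FrdICatStub.{u, v, w} D₂} {S₁ : BiKummerSetting X₁ T₁ D₁ VD₁} {S₂ : BiKummerSetting X₂ T₂ D₂ VD₂}

/-! ### Common divisors of `Div(−)` inside the model Frobenioid -/

/-- In the tempered (= model) Frobenioid, a factorisation `s = t ≫ w` exhibits `Div(t)` as a divisor of
`Div(s)`: `Div(t ≫ w) = Base(t)^* Div(w) + deg_Fr(w)·Div(t)` ([FrdI] Thm. 5.2 (i) composition law).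
[cite: MochizukiFrdI2008, Thm. 5.2 (i) p.100] -/
theorem div_dvd_div_of_comp_eq (S : BiKummerSetting X₁ T₁ D₁ VD₁) {A A' B : S.C} (t : A ⟶ A')
    (w : A' ⟶ B) (s : A ⟶ B) (h : t ≫ w = s) : S.div t ∣ S.div s := by
  rw [← h]
  change ModelFrobenioid.div t ∣ ModelFrobenioid.div (t ≫ w)
  rw [ModelFrobenioid.div_comp]
  exact (dvd_pow_self _ (PNat.ne_zero _)).trans (dvd_mul_left _ _)

/-- Post-composing with an isomorphism does not change `Div` (`Φ` divisorial: isomorphisms have zero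
divisor `0` and Frobenius degree `1`). [cite: MochizukiFrdI2008, Thm. 5.2 (i) p.100] -/
private theorem div_comp_of_isIso (S : BiKummerSetting X₂ T₂ D₂ VD₂)
    (hΦd : Objectwise (fun M _ => IsDivisorial M) S.tf.divisorMonoid) {A A' B : S.C} (t : A ⟶ A')
    (e' : A' ⟶ B) [IsIso e'] : ModelFrobenioid.div (t ≫ e') = ModelFrobenioid.div t := by
  rw [ModelFrobenioid.div_comp, ModelFrobenioid.div_eq_one_of_isIso hΦd e', map_one, one_mul,
    ModelFrobenioid.degFr_eq_one_of_isIso e', PNat.one_coe, pow_one]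

/-- **The base-identity linear morphism `t = (1, id, r, 0) : A → (A_D, [A] + r)` of the model Frobenioid**
([FrdI] Thm. 5.2 (i)): (a) every `φ : A → B` with `r ^ deg_Fr(φ) ≤ Div(φ)`, say `Div(φ) = r^d · z`, factors
as `φ = t ≫ (d, Base φ, z, u_φ)` (the relation of the second factor at `[A] + r` is
`d([A] + r) + z = d[A] + Div φ`); (b) `Div(t ≫ e⁻¹) = r` for every isomorphism `e` onto the target of `t`
(`Φ` divisorial: isomorphisms have zero divisor `0`). [cite: MochizukiFrdI2008, Thm. 5.2 (i) p.100] -/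
private theorem exists_shift (S : BiKummerSetting X₂ T₂ D₂ VD₂)
    (hΦd : Objectwise (fun M _ => IsDivisorial M) S.tf.divisorMonoid) (A : S.C)
    (r : S.tf.divisorMonoid.obj (op A.base)) :
    ∃ (A' : S.C) (t : A ⟶ A'),
      (∀ {B : S.C} (φ : A ⟶ B) (z : S.tf.divisorMonoid.obj (op A.base)),
          ModelFrobenioid.div φ = r ^ (ModelFrobenioid.degFr φ : ℕ) * z → ∃ w : A' ⟶ B, t ≫ w = φ) ∧
      ∀ {B : S.C} (e' : A' ⟶ B), IsIso e' → ModelFrobenioid.div (t ≫ e') = r := by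
  refine ⟨⟨A.base, A.cls * Algebra.GrothendieckGroup.of r⟩,
    ModelFrobenioid.mkHom A ⟨A.base, A.cls * Algebra.GrothendieckGroup.of r⟩ 1 (𝟙 A.base) r 1 (by
      rw [PNat.one_coe, pow_one, pullGp_id, map_one, mul_one]), ?_, ?_⟩
  · intro B φ z hz
    have hrel : (A.cls * Algebra.GrothendieckGroup.of r) ^ (ModelFrobenioid.degFr φ : ℕ) *
          Algebra.GrothendieckGroup.of z =
        pullGp S.tf.divisorMonoid (ModelFrobenioid.baseMap φ) B.cls *
          Literature.AlgebraicGeometry.Frobenioids.divB S.tf.divisorMonoid S.tf.ratFnFunctor S.tf.divBNatTrans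
            (op A.base) (ModelFrobenioid.unit φ) := by
      rw [← ModelFrobenioid.rel φ, hz, mul_pow, mul_assoc, ← map_pow, ← map_mul]
    refine ⟨ModelFrobenioid.mkHom ⟨A.base, A.cls * Algebra.GrothendieckGroup.of r⟩ B
      (ModelFrobenioid.degFr φ) (ModelFrobenioid.baseMap φ :) z (ModelFrobenioid.unit φ :) hrel, ?_⟩
    refine ModelFrobenioid.hom_ext ?_ ?_ ?_ ?_
    · change ModelFrobenioid.degFr φ * 1 = ModelFrobenioid.degFr φ
      rw [mul_one]
    · change 𝟙 A.base ≫ ModelFrobenioid.baseMap φ = ModelFrobenioid.baseMap φ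
      rw [Category.id_comp]
    · rw [ModelFrobenioid.div_comp]
      change (S.tf.divisorMonoid.map (𝟙 A.base).op).hom z * r ^ (ModelFrobenioid.degFr φ : ℕ) =
        ModelFrobenioid.div φ
      rw [ModelFrobenioid.map_id_apply_Φ, hz, mul_comm]
    · rw [ModelFrobenioid.unit_comp]
      change (S.tf.ratFnFunctor.map (𝟙 A.base).op).hom (ModelFrobenioid.unit φ) *
          1 ^ (ModelFrobenioid.degFr φ : ℕ) = ModelFrobenioid.unit φ
      rw [ModelFrobenioid.map_id_apply_B, one_pow, mul_one]
  · intro B e' he'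
    exact (div_comp_of_isIso S hΦd _ e').trans rfl

/-! ### Transport along the equivalence `Ψ` (full faithfulness) -/

/-- If `Ψ s = t₂ ≫ w₂` in `C₂` and `e : Ψ A₁ ≅ Z`, then `s` factors in `C₁` through the preimage
`t₁ : A → A₁` of `t₂ ≫ e⁻¹` (full faithfulness of `Ψ`). [cite: MochizukiEtTh2009, Thm 4.4 p.95] -/
private theorem exists_comp_preimage_eq (h : Thm44Hyp S₁ S₂) {A B A₁ : S₁.C} {Z : S₂.C}
    (e : h.Ψ.functor.obj A₁ ≅ Z) (s : A ⟶ B) (t₂ : h.Ψ.functor.obj A ⟶ Z) (w₂ : Z ⟶ h.Ψ.functor.obj B)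
    (hs : t₂ ≫ w₂ = h.Ψ.functor.map s) :
    ∃ w₁ : A₁ ⟶ B, h.Ψ.functor.preimage (t₂ ≫ e.inv) ≫ w₁ = s := by
  refine ⟨h.Ψ.functor.preimage (e.hom ≫ w₂), h.Ψ.functor.map_injective ?_⟩
  rw [Functor.map_comp, Functor.map_preimage, Functor.map_preimage, Category.assoc,
    e.inv_hom_id_assoc, hs]

/-! ### T44-L12 -/

/-- **T44-L12 in the [FrdI] Prop. 4.1 (iii) reading** (proof of Thm. 4.4, p.95 ll.10–12: "`Ψ` preserves …
pairs … whose `Div(−)`'s have disjoint supports"): for settings whose `DisjointSupports` fields imply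
(side 1), resp. are implied by (side 2), "every common divisor of the two elements is `0`", an equivalence
`Ψ` that preserves isometries carries pairs `(s', s'')` with `DisjointSupports (Div s') (Div s'')` to such
pairs — via the base-identity linear morphisms `(1, id, y^{1/(d′d″)}, 0)` through which `Ψ s'`, `Ψ s''`
factor (`Φ₂` perfect, §4 p.86) and the transport of that factorisation along `Ψ⁻¹` (module docstring).
Modulo `Φ₂` divisorial ([FrdI] Thm. 5.2 standing hypothesis). [cite: MochizukiEtTh2009, Thm 4.4 p.95] -/
theorem Thm44Hyp.preservesDisjointSupports_of (h : Thm44Hyp S₁ S₂)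
    (hiso : ∀ ⦃A B : S₁.C⦄ (φ : A ⟶ B), S₁.IsIsometry φ → S₂.IsIsometry (h.Ψ.functor.map φ))
    (hΦd₂ : Objectwise (fun M _ => IsDivisorial M) S₂.tf.divisorMonoid)
    (hDS₁ : ∀ {A : D₁ᵒᵖ} {a b : S₁.tf.Φ.carrier A}, S₁.DisjointSupports a b →
      ∀ x : S₁.tf.Φ.carrier A, x ∣ a → x ∣ b → x = 1)
    (hDS₂ : ∀ {A : D₂ᵒᵖ} {a b : S₂.tf.Φ.carrier A},
      (∀ x : S₂.tf.Φ.carrier A, x ∣ a → x ∣ b → x = 1) → S₂.DisjointSupports a b) :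
    h.PreservesDisjointSupports := by
  intro A B s' s'' hds
  apply hDS₂
  intro y hy' hy''
  -- work in the model Frobenioid's `Φ₂((Ψ A)_D)`
  have hperf : IsPerfect (S₂.tf.divisorMonoid.obj (op (h.Ψ.functor.obj A).base)) := S₂.isPerfect _
  have hy₁ : (y : S₂.tf.divisorMonoid.obj (op (h.Ψ.functor.obj A).base)) ∣
      ModelFrobenioid.div (h.Ψ.functor.map s') := hy'
  have hy₂ : (y : S₂.tf.divisorMonoid.obj (op (h.Ψ.functor.obj A).base)) ∣
      ModelFrobenioid.div (h.Ψ.functor.map s'') := hy''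
  change (y : S₂.tf.divisorMonoid.obj (op (h.Ψ.functor.obj A).base)) = 1
  -- `r := y^{1/(d′d″)}` in the perfect monoid `Φ₂((Ψ A)_D)`
  obtain ⟨r, hr⟩ := (hperf.bijective_pow
    ((ModelFrobenioid.degFr (h.Ψ.functor.map s') : ℕ) * ModelFrobenioid.degFr (h.Ψ.functor.map s''))
    (Nat.mul_pos (ModelFrobenioid.degFr (h.Ψ.functor.map s')).pos
      (ModelFrobenioid.degFr (h.Ψ.functor.map s'')).pos)).2
    (y : S₂.tf.divisorMonoid.obj (op (h.Ψ.functor.obj A).base))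
  simp only at hr
  rw [← hr] at hy₁ hy₂ ⊢
  -- `r^{d′} ≤ Div(Ψ s')`, `r^{d″} ≤ Div(Ψ s'')`
  obtain ⟨z', hz'⟩ := (pow_dvd_pow r (Nat.le_mul_of_pos_right
    (ModelFrobenioid.degFr (h.Ψ.functor.map s') : ℕ)
    (ModelFrobenioid.degFr (h.Ψ.functor.map s'')).pos)).trans hy₁
  obtain ⟨z'', hz''⟩ := (pow_dvd_pow r (Nat.le_mul_of_pos_left
    (ModelFrobenioid.degFr (h.Ψ.functor.map s'') : ℕ)
    (ModelFrobenioid.degFr (h.Ψ.functor.map s')).pos)).trans hy₂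
  -- both `Ψ s'`, `Ψ s''` factor through `t₂ = (1, id, r, 0) : Ψ A → A₂'`
  obtain ⟨A₂', t₂, hfac, hdiv⟩ := exists_shift S₂ hΦd₂ (h.Ψ.functor.obj A) r
  obtain ⟨w', hw'⟩ := hfac (h.Ψ.functor.map s') z' hz'
  obtain ⟨w'', hw''⟩ := hfac (h.Ψ.functor.map s'') z'' hz''
  -- transport: `s'`, `s''` factor through `t₁ := Ψ⁻¹(t₂ ≫ ε⁻¹)`
  obtain ⟨e⟩ : Nonempty (h.Ψ.functor.obj (h.Ψ.inverse.obj A₂') ≅ A₂') := ⟨h.Ψ.counitIso.app _⟩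
  obtain ⟨v', hv'⟩ := exists_comp_preimage_eq h e s' t₂ w' hw'
  obtain ⟨v'', hv''⟩ := exists_comp_preimage_eq h e s'' t₂ w'' hw''
  have h1 := div_dvd_div_of_comp_eq S₁ _ v' s' hv'
  have h2 := div_dvd_div_of_comp_eq S₁ _ v'' s'' hv''
  -- so `Div t₁ = 0`, hence `Div (Ψ t₁) = 0`; but `Ψ t₁ = t₂ ≫ ε⁻¹` has `Div = r`
  have hΨt₁ := hiso _ (hDS₁ hds _ h1 h2)
  change ModelFrobenioid.div (h.Ψ.functor.map (h.Ψ.functor.preimage _)) = 1 at hΨt₁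
  rw [Functor.map_preimage, hdiv e.inv inferInstance] at hΨt₁
  rw [hΨt₁, one_pow]
  rfl

/-- **T44-L12 from T44-L03** (same reading): with "`Ψ` preserves isometries" taken from the [FrdI]
Thm. 3.4 (ii) input `PreservesFrobeniusStructure` (sub-node T44-L03).
[cite: MochizukiEtTh2009, Thm 4.4 p.95] -/
theorem Thm44Hyp.preservesDisjointSupports_of_preservesFrobeniusStructure (h : Thm44Hyp S₁ S₂)
    (h3 : h.PreservesFrobeniusStructure)
    (hΦd₂ : Objectwise (fun M _ => IsDivisorial M) S₂.tf.divisorMonoid)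
    (hDS₁ : ∀ {A : D₁ᵒᵖ} {a b : S₁.tf.Φ.carrier A}, S₁.DisjointSupports a b →
      ∀ x : S₁.tf.Φ.carrier A, x ∣ a → x ∣ b → x = 1)
    (hDS₂ : ∀ {A : D₂ᵒᵖ} {a b : S₂.tf.Φ.carrier A},
      (∀ x : S₂.tf.Φ.carrier A, x ∣ a → x ∣ b → x = 1) → S₂.DisjointSupports a b) :
    h.PreservesDisjointSupports :=
  h.preservesDisjointSupports_of h3.2.1 hΦd₂ hDS₁ hDS₂

end BiKummerSetting

/-! ### At the canonical instances -/

namespace BiKummerSetting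

universe u₀ v₀ u v w

variable {K : Type u₀} [Field K] {K' : Type u₀} [Field K'] {D₀ : Type u₀} [Category.{v₀} D₀]
  {V : FrdIMonoidStub.{w}}
  {X₁ : SemiGraphs.TemperedArithmeticGroup.{u₀} K} {X₂ : SemiGraphs.TemperedArithmeticGroup.{u₀} K'}
  {D₀' : Type u₀} [Category.{v₀} D₀']
  {T₁ : RealifiedDivisorMonoids (D₀ := D₀) V} {T₂ : RealifiedDivisorMonoids (D₀ := D₀') V}
  {D₁ D₂ : Type u} [Category.{v} D₁] [Category.{v} D₂] {VD₁ : FrdICatStub.{u, v, w} D₁}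
  {VD₂ : FrdICatStub.{u, v, w} D₂} {S₁ : BiKummerSetting X₁ T₁ D₁ VD₁} {S₂ : BiKummerSetting X₂ T₂ D₂ VD₂}

/-- **Row T44-L12 for settings whose `DisjointSupports` IS the [FrdI] Prop. 4.1 (iii) predicate** (as for
`mkOfModelCanonical` on both sides: `mkOfModelCanonical_disjointSupports`, an `Iff.rfl`), modulo T44-L03's
isometry clause and `Φ₂` divisorial. [cite: MochizukiEtTh2009, Thm 4.4 p.95] -/
theorem Thm44Hyp.preservesDisjointSupports_canonical (h : Thm44Hyp S₁ S₂)
    (hDS₁ : ∀ {A : D₁ᵒᵖ} (a b : S₁.tf.Φ.carrier A), S₁.DisjointSupports a b ↔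
      ∀ x : S₁.tf.Φ.carrier A, x ∣ a → x ∣ b → x = 1)
    (hDS₂ : ∀ {A : D₂ᵒᵖ} (a b : S₂.tf.Φ.carrier A), S₂.DisjointSupports a b ↔
      ∀ x : S₂.tf.Φ.carrier A, x ∣ a → x ∣ b → x = 1)
    (hiso : ∀ ⦃A B : S₁.C⦄ (φ : A ⟶ B), S₁.IsIsometry φ → S₂.IsIsometry (h.Ψ.functor.map φ))
    (hΦd₂ : Objectwise (fun M _ => IsDivisorial M) S₂.tf.divisorMonoid) :
    h.PreservesDisjointSupports :=
  h.preservesDisjointSupports_of hiso hΦd₂ (fun hab => (hDS₁ _ _).mp hab) (fun hab => (hDS₂ _ _).mpr hab)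

end BiKummerSetting

end Literature.AnabelianGeometry.EtaleTheta

end
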